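import Summits.QuantumFields.YangMills.Theorems.FluctuationComparisonRegPrIntLS2BetaRelativeFieldLetterTwoTowerNbhd
import Summits.QuantumFields.YangMills.Theorems.FluctuationComparisonRegPrIntLS2BetaCorrMeanFlux
import HarnessLib

/-!
# S2β · letter (D♮) REL-TEL, feeder F2-rel (UV3-NODE §84.4 (H♭)(i) «TWO-TOWER relative field letter along the SAME combs»), FILE C4:
# THE TWO-TOWER FIELD LETTER IN ℓ² — `‖δ(P, P⁰)‖_{ℓ²(fine bonds)} ≤ C₁·‖δ_plaq(W,W⁰)‖₂ + C₂·‖δ_plaq(U,U⁰)‖₂ + C₃·‖dev(W,W⁰)‖₂ + C₄·‖dev(U,U⁰)‖₂`, one level,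
# `P = W·U⁻¹`, `P⁰ = W⁰·U⁰⁻¹` the flaps of two comb-axial pairs over backgrounds reproducing the (0.4) averages (`SU(N)`, `ℰ = exp∘mean∘log`)

Cell `ym3-torus` (YM ladder rung R3 = continuum `SU(2)` Yang–Mills on the three-torus — a RUNG: NOT d = 4, NOT infinite volume, NOT a mass gap, NOT Clay).
Width seat «width 21» `ym3-torus-px21` (gen 23), FREE px helper on crux `stmt-QuantumFields-20520`; `--kind proof --supports stmt-QuantumFields-20520 --as helper`,
count-neutral, DEFINITION-FREE (0 `def`, 0 `instance`, 0 `notation`, 0 `sorry`; ONE decl-local `set_option maxHeartbeats 400000 in` per the cell's CI-cliff rule on the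
final assembly).

WHERE IT DOCKS.  px12 g24's (H♭)∕(H♭♭) (✓p822621 `dockRel_inner`, ✓`…StageAxialLetters`, ⧗`…StageAxialFeedback`) asks, level by level along the two STAGE towers, for
`‖dist1 (P_j·P⁰_j⁻¹)‖_{ℓ²}` in terms of (i) the relative fine plaquettes of the two towers at level `j` (→ px10 g23's relative key lemma), (ii) the relative plaquettes of the
two LIFTS (→ (F3)-rel ✓p821688), (iii) same-level ∕ lift-level bond deviations with SMALL coefficients (→ the feedback weights `W j u`), (iv) the relative spine quotients
(→ F4-rel ✓p824227).  This file is the one-tower F2 (✓`sq_sum_le_plaq`, px13 g22) made TWO-TOWER, with crude neighbourhood Schur constants (polynomial in `L`; they sit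
in front of `S`-type and small-coefficient terms only — never in front of a bare `B_{j+1}`).

CONTENT.
* §1 Minkowski for five terms; the two bond-indexed neighbourhood kernels with a fine-BOND index `b` and datum near `blockOf b₋` (rows px10 ✓`card_nbhd_le` ∕ F4-rel
  ✓`card_bond_nbhd3_le`, columns by `near_symm`): `sqrt_sum_sq_nbhdP_le`, `sqrt_sum_sq_nbhdB_le`; the face-bond spine count via px13's ✓`sum_faceBonds_le`.
* §2 ★★`dist1_flap_rel_le_nbhd_SU` — the pointwise two-tower letter at EVERY fine bond (`SU(N)`; interior by ✓`dist1_flap_rel_le_interior_nbhd`, face by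
  ✓`dist1_flap_rel_le_face_nbhd` with `σ ≤ 3Kθ_W` from G12 ✓`dist1_corr_le_mean` and the spine quotient read as `dist1 (κ_c(W⁰)⁻¹·κ_c(W))`, ✓`dist1_spine_rel_eq_corr_rel`).
* §3 ★★★`sqrt_sum_dist1_flap_rel_sq_le` — THE LETTER (+ `'`: px12's chord orientation `dist1 (P·P⁰⁻¹)`).
Tower 1 `(W, U)` carries every SIZE (`θ_W`, `θ_U`): take it := the BACKGROUND (argmin) tower, tower 0 := the history tower (px12 g24 13:07:55Z «SIZE := BKG-tower»); the
left side is symmetric.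

HONEST SCOPE.  Finite sums and counts over landed pointwise letters; crude constants; nothing of Bałaban's analysis is asserted; (H♭♭)'s ASSEMBLY (the feedback recursion
with these letters as inputs), the BKG-tower size letter, the relative key lemma's instantiation on the T³ record (px10), (D-ax)∕(D♮), (F♮), `hIrr`∕`hA`, GAP♯∘
(`stub_uniformFibreGapOrbit`), S2β, the five registered stubs (0∕5), crux 20520, 19936, 19200 and `YM3TorusSU2` are NOT proved; no registered stub is closed; rung R3 =
SU(2) YM₃ on T³ — NOT d = 4, NOT infinite volume, NOT a mass gap, NOT Clay; the Yang–Mills mass gap is NOT proved.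
References: T. Bałaban, CMP **99** (1985) 75–102 [Balaban1985RegularSpaces] (Lemma 1 (1.24)–(1.26) pp.79–80, (1.29) p.81); CMP **98** (1985) 17–51 [Balaban1985Averaging]
((19)–(21) pp.21–22); CMP **109** (1987) 249–301 [Balaban1987RG1] ((0.3)–(0.4) pp.252–253).
-/

set_option autoImplicit false

noncomputable section

namespace Summit.QuantumFields.YangMills.Theorems.FluctuationComparisonRegPrIntLS2BetaRelativeFieldLetterTwoTowerL2

open Finset
open Literature.MathematicalPhysics.QuantumFieldTheory.Balaban1983to89
open T4Continuum BlockAveraging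
open B10Eq27TorusAxialLog (axialT)
open ExpMeanLog (deltaSU expMeanLogSU lt_third_of_lt_deltaSU)
open T4TiltOscillation (bdev)
open Summit.QuantumFields.YangMills.Theorems.FluctuationComparisonRegPrIntLS2BetaSchurTest (schur_test_sq)
open Summit.QuantumFields.YangMills.Theorems.FluctuationComparisonRegPrIntLS2BetaNeighbourhoodKernelTorus (near_symm card_nbhd_le)
open Summit.QuantumFields.YangMills.Theorems.FluctuationComparisonRegPrIntLS2BetaKeyLemmaSkeleton (sqrt_sum_sq_add_le sqrt_sum_sq_le_of_le_add)
open Summit.QuantumFields.YangMills.Theorems.FluctuationComparisonRegPrIntLS2BetaRelativeFieldSquareSum (sum_faceBonds_le)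
open Summit.QuantumFields.YangMills.Theorems.FluctuationComparisonRegPrIntLS2BetaRelativeFieldLetter (dist1_axialAvg_mul_inv_eq_corr)
open Summit.QuantumFields.YangMills.Theorems.FluctuationComparisonRegPrIntLS2BetaCorrMeanFlux (dist1_corr_le_mean)
open Summit.QuantumFields.YangMills.Theorems.FluctuationComparisonRegPrIntLS2BetaCorrLetterL2Relative (card_bond_nbhd3_le sqrt_sum_dist1_corr_rel_sq_le)
open Summit.QuantumFields.YangMills.Theorems.FluctuationComparisonRegPrIntLS2BetaRelativeFieldLetterTwoTower (dist1_spine_rel_eq_corr_rel)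
open Summit.QuantumFields.YangMills.Theorems.FluctuationComparisonRegPrIntLS2BetaRelativeFieldLetterTwoTowerNbhd
  (dist1_flap_rel_le_interior_nbhd dist1_flap_rel_le_face_nbhd)

variable {P : Params} {j : ℕ}

/-! ## §1 Minkowski for five terms; the two fine-bond-indexed neighbourhood kernels; the face-bond spine count -/

/-- `0 ≤ f ≤ t₁ + t₂ + t₃ + t₄ + t₅` pointwise ⟹ `‖f‖₂ ≤ Σ_k ‖t_k‖₂` (finite Minkowski, iterated). [folklore] -/
theorem sqrt_sum_sq_le_of_le_add5 {ι : Type*} (s : Finset ι) (f t₁ t₂ t₃ t₄ t₅ : ι → ℝ) (hf : ∀ i ∈ s, 0 ≤ f i)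
    (h : ∀ i ∈ s, f i ≤ t₁ i + t₂ i + t₃ i + t₄ i + t₅ i) :
    √(∑ i ∈ s, f i ^ 2) ≤ √(∑ i ∈ s, t₁ i ^ 2) + √(∑ i ∈ s, t₂ i ^ 2) + √(∑ i ∈ s, t₃ i ^ 2) + √(∑ i ∈ s, t₄ i ^ 2) + √(∑ i ∈ s, t₅ i ^ 2) := by
  have h1 := sqrt_sum_sq_le_of_le_add s f (fun i => t₁ i + t₂ i + t₃ i + t₄ i) t₅ hf (fun i hi => by simpa [add_assoc] using h i hi)
  have h2 := sqrt_sum_sq_add_le s (fun i => t₁ i + t₂ i + t₃ i) t₄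
  have h3 := sqrt_sum_sq_add_le s (fun i => t₁ i + t₂ i) t₃
  have h4 := sqrt_sum_sq_add_le s t₁ t₂
  linarith

/-- ★ **PLAQUETTE DATUM, FINE-BOND INDEX**: for a non-negative coarse-indexed bound, `√(Σ_{b : PBond_j} (Σ_{q ∈ N(blockOf b₋)} g q)²) ≤ √((3^dL^dd²)·(3^dL^dd))·√(Σ_q g q²)`
(rows px10 ✓`card_nbhd_le`, columns F4-rel ✓`card_bond_nbhd3_le` through `near_symm`). [cite: Balaban1985Averaging, (19) p.21] -/
theorem sqrt_sum_sq_nbhdP_le (hj : j + 1 ≤ P.m + P.K) (g : Plaq P j → ℝ) :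
    √(∑ b : PBond P j, (∑ q ∈ Finset.univ.filter (fun q : Plaq P j => ∀ κ, blockOf q.src κ = blockOf b.src κ ∨ blockOf q.src κ = blockOf b.src κ + 1 ∨
        blockOf q.src κ = blockOf b.src κ - 1), g q) ^ 2) ≤
      √(((3 ^ P.d * P.L ^ P.d * P.d ^ 2 : ℕ) : ℝ) * ((3 ^ P.d * P.L ^ P.d * P.d : ℕ) : ℝ)) * √(∑ q : Plaq P j, g q ^ 2) := by
  classical
  have h := schur_test_sq (Finset.univ : Finset (PBond P j)) (Finset.univ : Finset (Plaq P j))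
    (fun b q => if (∀ κ, blockOf q.src κ = blockOf b.src κ ∨ blockOf q.src κ = blockOf b.src κ + 1 ∨ blockOf q.src κ = blockOf b.src κ - 1) then (1 : ℝ) else 0)
    (fun b _ q _ => by positivity) (R := ((3 ^ P.d * P.L ^ P.d * P.d ^ 2 : ℕ) : ℝ)) (C := ((3 ^ P.d * P.L ^ P.d * P.d : ℕ) : ℝ)) (by positivity)
    (fun b _ => by
      rw [← Finset.sum_filter, Finset.sum_const, nsmul_eq_mul, mul_one]
      exact_mod_cast card_nbhd_le hj (blockOf b.src))
    (fun q _ => by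
      rw [← Finset.sum_filter, Finset.sum_const, nsmul_eq_mul, mul_one]
      have hsub : Finset.univ.filter (fun b : PBond P j => ∀ κ, blockOf q.src κ = blockOf b.src κ ∨ blockOf q.src κ = blockOf b.src κ + 1 ∨
          blockOf q.src κ = blockOf b.src κ - 1) ⊆ Finset.univ.filter (fun b : PBond P j => ∀ κ, blockOf b.src κ = blockOf q.src κ ∨
            blockOf b.src κ = blockOf q.src κ + 1 ∨ blockOf b.src κ = blockOf q.src κ - 1) := by
        intro b hb
        rw [Finset.mem_filter] at hb ⊢
        exact ⟨hb.1, near_symm hb.2⟩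
      exact_mod_cast (Finset.card_le_card hsub).trans (card_bond_nbhd3_le hj (blockOf q.src))) g
  simp only [ite_mul, one_mul, zero_mul, Finset.sum_ite, Finset.sum_const_zero, add_zero] at h
  have h' : ∑ b : PBond P j, (∑ q ∈ Finset.univ.filter (fun q : Plaq P j => ∀ κ, blockOf q.src κ = blockOf b.src κ ∨ blockOf q.src κ = blockOf b.src κ + 1 ∨
      blockOf q.src κ = blockOf b.src κ - 1), g q) ^ 2 ≤
      ((3 ^ P.d * P.L ^ P.d * P.d ^ 2 : ℕ) : ℝ) * ((3 ^ P.d * P.L ^ P.d * P.d : ℕ) : ℝ) * ∑ q : Plaq P j, g q ^ 2 := by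
    convert h using 4
  calc √(∑ b : PBond P j, (∑ q ∈ Finset.univ.filter (fun q : Plaq P j => ∀ κ, blockOf q.src κ = blockOf b.src κ ∨ blockOf q.src κ = blockOf b.src κ + 1 ∨
        blockOf q.src κ = blockOf b.src κ - 1), g q) ^ 2)
      ≤ √(((3 ^ P.d * P.L ^ P.d * P.d ^ 2 : ℕ) : ℝ) * ((3 ^ P.d * P.L ^ P.d * P.d : ℕ) : ℝ) * ∑ q : Plaq P j, g q ^ 2) := Real.sqrt_le_sqrt h'
    _ = _ := Real.sqrt_mul (by positivity) _

/-- ★ **BOND DATUM, FINE-BOND INDEX**: `√(Σ_{b : PBond_j} (Σ_{b′ ∈ N_b(blockOf b₋)} g b′)²) ≤ √((3^dL^dd)·(3^dL^dd))·√(Σ_{b′} g b′²)` (rows and columns F4-rel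
✓`card_bond_nbhd3_le`). [cite: Balaban1985Averaging, (19) p.21] -/
theorem sqrt_sum_sq_nbhdB_le (hj : j + 1 ≤ P.m + P.K) (g : PBond P j → ℝ) :
    √(∑ b : PBond P j, (∑ b' ∈ Finset.univ.filter (fun b' : PBond P j => ∀ κ, blockOf b'.src κ = blockOf b.src κ ∨ blockOf b'.src κ = blockOf b.src κ + 1 ∨
        blockOf b'.src κ = blockOf b.src κ - 1), g b') ^ 2) ≤
      √(((3 ^ P.d * P.L ^ P.d * P.d : ℕ) : ℝ) * ((3 ^ P.d * P.L ^ P.d * P.d : ℕ) : ℝ)) * √(∑ b' : PBond P j, g b' ^ 2) := by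
  classical
  have h := schur_test_sq (Finset.univ : Finset (PBond P j)) (Finset.univ : Finset (PBond P j))
    (fun b b' => if (∀ κ, blockOf b'.src κ = blockOf b.src κ ∨ blockOf b'.src κ = blockOf b.src κ + 1 ∨ blockOf b'.src κ = blockOf b.src κ - 1) then (1 : ℝ)
      else 0)
    (fun b _ b' _ => by positivity) (R := ((3 ^ P.d * P.L ^ P.d * P.d : ℕ) : ℝ)) (C := ((3 ^ P.d * P.L ^ P.d * P.d : ℕ) : ℝ)) (by positivity)
    (fun b _ => by
      rw [← Finset.sum_filter, Finset.sum_const, nsmul_eq_mul, mul_one]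
      exact_mod_cast card_bond_nbhd3_le hj (blockOf b.src))
    (fun b' _ => by
      rw [← Finset.sum_filter, Finset.sum_const, nsmul_eq_mul, mul_one]
      have hsub : Finset.univ.filter (fun b : PBond P j => ∀ κ, blockOf b'.src κ = blockOf b.src κ ∨ blockOf b'.src κ = blockOf b.src κ + 1 ∨
          blockOf b'.src κ = blockOf b.src κ - 1) ⊆ Finset.univ.filter (fun b : PBond P j => ∀ κ, blockOf b.src κ = blockOf b'.src κ ∨
            blockOf b.src κ = blockOf b'.src κ + 1 ∨ blockOf b.src κ = blockOf b'.src κ - 1) := by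
        intro b hb
        rw [Finset.mem_filter] at hb ⊢
        exact ⟨hb.1, near_symm hb.2⟩
      exact_mod_cast (Finset.card_le_card hsub).trans (card_bond_nbhd3_le hj (blockOf b'.src))) g
  simp only [ite_mul, one_mul, zero_mul, Finset.sum_ite, Finset.sum_const_zero, add_zero] at h
  have h' : ∑ b : PBond P j, (∑ b' ∈ Finset.univ.filter (fun b' : PBond P j => ∀ κ, blockOf b'.src κ = blockOf b.src κ ∨ blockOf b'.src κ = blockOf b.src κ + 1 ∨
      blockOf b'.src κ = blockOf b.src κ - 1), g b') ^ 2 ≤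
      ((3 ^ P.d * P.L ^ P.d * P.d : ℕ) : ℝ) * ((3 ^ P.d * P.L ^ P.d * P.d : ℕ) : ℝ) * ∑ b' : PBond P j, g b' ^ 2 := by
    convert h using 4
  calc √(∑ b : PBond P j, (∑ b' ∈ Finset.univ.filter (fun b' : PBond P j => ∀ κ, blockOf b'.src κ = blockOf b.src κ ∨ blockOf b'.src κ = blockOf b.src κ + 1 ∨
        blockOf b'.src κ = blockOf b.src κ - 1), g b') ^ 2)
      ≤ √(((3 ^ P.d * P.L ^ P.d * P.d : ℕ) : ℝ) * ((3 ^ P.d * P.L ^ P.d * P.d : ℕ) : ℝ) * ∑ b' : PBond P j, g b' ^ 2) := Real.sqrt_le_sqrt h'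
    _ = _ := Real.sqrt_mul (by positivity) _

/-- A scaled neighbourhood sum in `ℓ²`: `‖c·S‖₂ = c·‖S‖₂` for `0 ≤ c`. [folklore] -/
private theorem sqrt_sum_mul_sq {ι : Type*} (s : Finset ι) (c : ℝ) (hc : 0 ≤ c) (S : ι → ℝ) :
    √(∑ i ∈ s, (c * S i) ^ 2) = c * √(∑ i ∈ s, S i ^ 2) := by
  simp only [mul_pow, ← Finset.mul_sum]
  rw [Real.sqrt_mul (sq_nonneg c), Real.sqrt_sq hc]

/-- ★ **THE SPINE TERM OVER THE FACE BONDS**: `√(Σ_b F_b²) ≤ √(L^{d−1})·√(Σ_c φ_c²)` for `F_b := φ_{c(b)}` on face bonds and `0` elsewhere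
(px13's ✓`sum_faceBonds_le`). [cite: Balaban1987RG1, (0.3) p.252] -/
theorem sqrt_sum_face_sq_le (hj : j + 1 ≤ P.m + P.K) (φ : PBond P (j + 1) → ℝ) :
    √(∑ b : PBond P j, (if (b.src b.dir).val % P.L + 1 = P.L then φ ⟨blockOf b.src, b.dir⟩ else 0) ^ 2) ≤
      √((P.L ^ (P.d - 1) : ℕ) : ℝ) * √(∑ c : PBond P (j + 1), φ c ^ 2) := by
  classical
  have h1 : ∑ b : PBond P j, (if (b.src b.dir).val % P.L + 1 = P.L then φ ⟨blockOf b.src, b.dir⟩ else 0) ^ 2 =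
      ∑ b ∈ (univ : Finset (PBond P j)).filter (fun b => (b.src b.dir).val % P.L + 1 = P.L), φ ⟨blockOf b.src, b.dir⟩ ^ 2 := by
    rw [Finset.sum_filter]
    exact Finset.sum_congr rfl fun b _ => by split_ifs <;> simp
  have h2 := sum_faceBonds_le hj (fun c => φ c ^ 2) (fun c => sq_nonneg _)
  rw [h1, ← Real.sqrt_mul (by positivity)]
  exact Real.sqrt_le_sqrt (by exact_mod_cast h2)

/-! ## §2 The pointwise two-tower letter at EVERY fine bond (`SU(N)`, backgrounds reproducing the (0.4) averages) -/

section SUN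

open scoped Matrix.Norms.L2Operator

variable {n : Type*} [Fintype n] [DecidableEq n] [Nonempty n]

/-- ★★ **THE TWO-TOWER LETTER AT EVERY FINE BOND, LOCAL SUM CURRENCY** (`SU(N)`, `ℰ = exp∘mean∘log`; standing range; tower 1 `(W, U)` carries the sizes `θ_W`, `θ_U`
with `Kθ_W ≤ ¼`, `Kθ_W < δ_N` (G12's guard for the spine size `dist1 κ_c(W) ≤ 3Kθ_W`); both pairs comb-axial from every block centre and BOTH backgrounds reproducing the
(0.4) averages along the spines): for the bond `⟨x, μ⟩`, with `y = blockOf x`, `c = ⟨y, μ⟩`, `K′ = (d+2)L`, `K = K′²∕4`,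
`δ(W_b·U_b⁻¹, W⁰_b·U⁰_b⁻¹) ≤ K·Σ_{N(y)}δ(W,W⁰) + K·Σ_{N(y)}δ(U,U⁰) + 2Kθ_W(K′+2)·Σ_{N_b(y)}dev(W,W⁰) + (2Kθ_U(K′+2) + 2(4Kθ_W + Kθ_U)K′)·Σ_{N_b(y)}dev(U,U⁰)
 + [face bond]·dist1 (κ_c(W⁰)⁻¹·κ_c(W))` (interior ✓`dist1_flap_rel_le_interior_nbhd`, face ✓`dist1_flap_rel_le_face_nbhd` + ✓`dist1_spine_rel_eq_corr_rel`).
[cite: Balaban1985RegularSpaces, Lemma 1 (1.25)-(1.26) pp.79-80; Balaban1987RG1, (0.4) p.253] -/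
theorem dist1_flap_rel_le_nbhd_SU (hj : j + 1 ≤ P.m + P.K) (W U W₀ U₀ : GaugeField P j (Matrix.specialUnitaryGroup n ℂ))
    (hax : ∀ z : Site P j, axialT W (emb (blockOf z)) z = axialT U (emb (blockOf z)) z)
    (hax₀ : ∀ z : Site P j, axialT W₀ (emb (blockOf z)) z = axialT U₀ (emb (blockOf z)) z)
    (havg : ∀ c : PBond P (j + 1), AveragingRT.axialAvg U c = avgFun (expMeanLogSU (n := n)) W c)
    (havg₀ : ∀ c : PBond P (j + 1), AveragingRT.axialAvg U₀ c = avgFun (expMeanLogSU (n := n)) W₀ c)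
    {θW θU : ℝ} (hθW0 : 0 ≤ θW) (hθU0 : 0 ≤ θU) (hW : PlaqSmall θW W) (hU : PlaqSmall θU U)
    (hθW4 : ((((P.d + 2) * P.L : ℕ) : ℝ) ^ 2 / 4) * θW ≤ 1 / 4) (hθWN : ((((P.d + 2) * P.L : ℕ) : ℝ) ^ 2 / 4) * θW < deltaSU n)
    (x : Site P j) (μ : Fin P.d) :
    dist1 ((W₀ ⟨x, μ⟩ * (U₀ ⟨x, μ⟩)⁻¹)⁻¹ * (W ⟨x, μ⟩ * (U ⟨x, μ⟩)⁻¹)) ≤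
      ((((P.d + 2) * P.L : ℕ) : ℝ) ^ 2 / 4) *
          ∑ q ∈ Finset.univ.filter (fun q : Plaq P j => ∀ κ, blockOf q.src κ = blockOf x κ ∨ blockOf q.src κ = blockOf x κ + 1 ∨
            blockOf q.src κ = blockOf x κ - 1), dist1 ((GaugeField.plaqHol W₀ q)⁻¹ * GaugeField.plaqHol W q) +
        ((((P.d + 2) * P.L : ℕ) : ℝ) ^ 2 / 4) *
          ∑ q ∈ Finset.univ.filter (fun q : Plaq P j => ∀ κ, blockOf q.src κ = blockOf x κ ∨ blockOf q.src κ = blockOf x κ + 1 ∨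
            blockOf q.src κ = blockOf x κ - 1), dist1 ((GaugeField.plaqHol U₀ q)⁻¹ * GaugeField.plaqHol U q) +
        (2 * (((((P.d + 2) * P.L : ℕ) : ℝ) ^ 2 / 4) * θW) * ((((P.d + 2) * P.L : ℕ) : ℝ) + 2)) *
          ∑ b' ∈ Finset.univ.filter (fun b' : PBond P j => ∀ κ, blockOf b'.src κ = blockOf x κ ∨ blockOf b'.src κ = blockOf x κ + 1 ∨
            blockOf b'.src κ = blockOf x κ - 1), dist1 (bdev W W₀ b') +
        (2 * (((((P.d + 2) * P.L : ℕ) : ℝ) ^ 2 / 4) * θU) * ((((P.d + 2) * P.L : ℕ) : ℝ) + 2) +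
            2 * (4 * (((((P.d + 2) * P.L : ℕ) : ℝ) ^ 2 / 4) * θW) + ((((P.d + 2) * P.L : ℕ) : ℝ) ^ 2 / 4) * θU) * (((P.d + 2) * P.L : ℕ) : ℝ)) *
          ∑ b' ∈ Finset.univ.filter (fun b' : PBond P j => ∀ κ, blockOf b'.src κ = blockOf x κ ∨ blockOf b'.src κ = blockOf x κ + 1 ∨
            blockOf b'.src κ = blockOf x κ - 1), dist1 (bdev U U₀ b') +
        (if (x μ).val % P.L + 1 = P.L then
          dist1 ((corr (expMeanLogSU (n := n)) W₀ ⟨blockOf x, μ⟩)⁻¹ * corr (expMeanLogSU (n := n)) W ⟨blockOf x, μ⟩) else 0) := by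
  classical
  have hK0 : (0 : ℝ) ≤ (((P.d + 2) * P.L : ℕ) : ℝ) ^ 2 / 4 := by positivity
  have hK'0 : (0 : ℝ) ≤ (((P.d + 2) * P.L : ℕ) : ℝ) := by positivity
  have hSBU0 : 0 ≤ ∑ b' ∈ Finset.univ.filter (fun b' : PBond P j => ∀ κ, blockOf b'.src κ = blockOf x κ ∨ blockOf b'.src κ = blockOf x κ + 1 ∨
      blockOf b'.src κ = blockOf x κ - 1), dist1 (bdev U U₀ b') := Finset.sum_nonneg fun _ _ => GaugeGroup.dist1_nonneg _
  have hcomm := FluctuationComparisonRegPrIntLS2BetaRelativeStokes.dist1_comm_le_SU (n := n)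
  by_cases hface : (x μ).val % P.L + 1 = P.L
  · -- FACE bond: the spine size `σ := 3Kθ_W` by G12, the relative spine quotient read as the relative correction factor
    rw [if_pos hface]
    have hloops : ∀ i, dist1 (loopHol W ⟨blockOf x, μ⟩ i) ≤ ((((P.d + 2) * P.L : ℕ) : ℝ) ^ 2 / 4) * θW :=
      fun i => LatticeWordStokes.dist1_loopHol_le hθW0 hW ⟨blockOf x, μ⟩ i
    have hcard : (0 : ℝ) < (Fintype.card (Idx P) : ℝ) := by exact_mod_cast Fintype.card_pos
    have hmean : ((Fintype.card (Idx P) : ℝ))⁻¹ * ∑ i, dist1 (loopHol W ⟨blockOf x, μ⟩ i) ≤ ((((P.d + 2) * P.L : ℕ) : ℝ) ^ 2 / 4) * θW := by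
      rw [inv_mul_le_iff₀ hcard]
      calc ∑ i, dist1 (loopHol W ⟨blockOf x, μ⟩ i) ≤ ∑ _i : Idx P, ((((P.d + 2) * P.L : ℕ) : ℝ) ^ 2 / 4) * θW := Finset.sum_le_sum fun i _ => hloops i
        _ = (Fintype.card (Idx P) : ℝ) * (((((P.d + 2) * P.L : ℕ) : ℝ) ^ 2 / 4) * θW) := by rw [Finset.sum_const, Finset.card_univ, nsmul_eq_mul]
    have hσ : dist1 (AveragingRT.axialAvg W ⟨blockOf x, μ⟩ * (AveragingRT.axialAvg U ⟨blockOf x, μ⟩)⁻¹) ≤ 3 * (((((P.d + 2) * P.L : ℕ) : ℝ) ^ 2 / 4) * θW) := by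
      rw [dist1_axialAvg_mul_inv_eq_corr (expMeanLogSU (n := n)) W U ⟨blockOf x, μ⟩ (havg _)]
      exact (dist1_corr_le_mean W ⟨blockOf x, μ⟩ hloops hθW4 hθWN).trans (by linarith)
    have h := dist1_flap_rel_le_face_nbhd hcomm hj W U W₀ U₀ hax hax₀ hθW0 hθU0 hW hU (rfl : blockOf x = blockOf x) hface hσ
    rw [dist1_spine_rel_eq_corr_rel (expMeanLogSU (n := n)) W U W₀ U₀ ⟨blockOf x, μ⟩ (havg _) (havg₀ _)] at h
    refine h.trans (le_of_eq ?_)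
    ring
  · -- INTERIOR bond
    rw [if_neg hface, add_zero]
    have hblock : blockOf (x.shift μ) = blockOf x := by rw [B10StarCount.blockOf_shift hj, if_neg hface]
    have h := dist1_flap_rel_le_interior_nbhd hcomm hj W U W₀ U₀ hax hax₀ hθW0 hθU0 hW hU (rfl : blockOf x = blockOf x) μ hblock
    have hextra : 0 ≤ (((((P.d + 2) * P.L : ℕ) : ℝ) ^ 2 / 4) * θW) * ((((P.d + 2) * P.L : ℕ) : ℝ) *
        ∑ b' ∈ Finset.univ.filter (fun b' : PBond P j => ∀ κ, blockOf b'.src κ = blockOf x κ ∨ blockOf b'.src κ = blockOf x κ + 1 ∨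
          blockOf b'.src κ = blockOf x κ - 1), dist1 (bdev U U₀ b')) := by positivity
    nlinarith [h, hextra]

/-! ## §3 THE LETTER -/

set_option maxHeartbeats 400000 in
/-- ★★★ **(F2-rel) THE TWO-TOWER FIELD LETTER IN ℓ²** (UV3-NODE §84.4 (H♭)(i); one level, `SU(N)`, `ℰ = exp∘mean∘log`; standing range): for two comb-axial pairs `(W, U)`,
`(W⁰, U⁰)` (✓(T4) ×2) whose backgrounds reproduce the (0.4) averages along the spines (✓(T5) + ✓`axialAvg_lift` ×2), with tower 1 carrying the sizes (`PlaqSmall θ_W W`,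
`PlaqSmall θ_U U`, `Kθ_W ≤ ¼`, `Kθ_W < δ_N`) and `PlaqSmall θ_{W⁰} W⁰` (guard, `Kθ_{W⁰} < δ_N`):
`‖dist1 ((W⁰·U⁰⁻¹)⁻¹·(W·U⁻¹))‖_{ℓ²(fine bonds)} ≤ K√(R_P C_B)·‖δ(W,W⁰)‖₂ + K√(R_P C_B)·‖δ(U,U⁰)‖₂ + 2Kθ_W(K′+2)√(C_B C_B)·‖dev(W,W⁰)‖₂
 + (2Kθ_U(K′+2) + 2(4Kθ_W + Kθ_U)K′)√(C_B C_B)·‖dev(U,U⁰)‖₂ + √(L^{d−1})·(3K√(R_P C₀)·‖δ(W,W⁰)‖₂ + 3K(2θ_W(K′+2))√(C_B C₀)·‖dev(W,W⁰)‖₂)`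
(`K′ = (d+2)L`, `K = K′²∕4`, `R_P = 3^dL^dd²`, `C_B = 3^dL^dd`, `C₀ = 3^dd`) — every term vanishes when the towers coincide; the `dev`-coefficients carry the small SIZES
`θ_W`, `θ_U`; the constants are polynomial in `L` and multiply relative data only. [cite: Balaban1985RegularSpaces, Lemma 1 (1.25)-(1.26) pp.79-80, (1.29) p.81; Balaban1987RG1, (0.4) p.253] -/
theorem sqrt_sum_dist1_flap_rel_sq_le (hj : j + 1 ≤ P.m + P.K) (W U W₀ U₀ : GaugeField P j (Matrix.specialUnitaryGroup n ℂ))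
    (hax : ∀ z : Site P j, axialT W (emb (blockOf z)) z = axialT U (emb (blockOf z)) z)
    (hax₀ : ∀ z : Site P j, axialT W₀ (emb (blockOf z)) z = axialT U₀ (emb (blockOf z)) z)
    (havg : ∀ c : PBond P (j + 1), AveragingRT.axialAvg U c = avgFun (expMeanLogSU (n := n)) W c)
    (havg₀ : ∀ c : PBond P (j + 1), AveragingRT.axialAvg U₀ c = avgFun (expMeanLogSU (n := n)) W₀ c)
    {θW θU θW₀ : ℝ} (hθW0 : 0 ≤ θW) (hθU0 : 0 ≤ θU) (hθW₀0 : 0 ≤ θW₀)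
    (hW : PlaqSmall θW W) (hU : PlaqSmall θU U) (hW₀ : PlaqSmall θW₀ W₀)
    (hθW4 : ((((P.d + 2) * P.L : ℕ) : ℝ) ^ 2 / 4) * θW ≤ 1 / 4) (hθWN : ((((P.d + 2) * P.L : ℕ) : ℝ) ^ 2 / 4) * θW < deltaSU n)
    (hθW₀N : ((((P.d + 2) * P.L : ℕ) : ℝ) ^ 2 / 4) * θW₀ < deltaSU n) :
    √(∑ b : PBond P j, dist1 ((W₀ b * (U₀ b)⁻¹)⁻¹ * (W b * (U b)⁻¹)) ^ 2) ≤
      ((((P.d + 2) * P.L : ℕ) : ℝ) ^ 2 / 4) * (√(((3 ^ P.d * P.L ^ P.d * P.d ^ 2 : ℕ) : ℝ) * ((3 ^ P.d * P.L ^ P.d * P.d : ℕ) : ℝ)) *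
          √(∑ q : Plaq P j, dist1 ((GaugeField.plaqHol W₀ q)⁻¹ * GaugeField.plaqHol W q) ^ 2)) +
        ((((P.d + 2) * P.L : ℕ) : ℝ) ^ 2 / 4) * (√(((3 ^ P.d * P.L ^ P.d * P.d ^ 2 : ℕ) : ℝ) * ((3 ^ P.d * P.L ^ P.d * P.d : ℕ) : ℝ)) *
          √(∑ q : Plaq P j, dist1 ((GaugeField.plaqHol U₀ q)⁻¹ * GaugeField.plaqHol U q) ^ 2)) +
        (2 * (((((P.d + 2) * P.L : ℕ) : ℝ) ^ 2 / 4) * θW) * ((((P.d + 2) * P.L : ℕ) : ℝ) + 2)) *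
          (√(((3 ^ P.d * P.L ^ P.d * P.d : ℕ) : ℝ) * ((3 ^ P.d * P.L ^ P.d * P.d : ℕ) : ℝ)) * √(∑ b : PBond P j, dist1 (bdev W W₀ b) ^ 2)) +
        (2 * (((((P.d + 2) * P.L : ℕ) : ℝ) ^ 2 / 4) * θU) * ((((P.d + 2) * P.L : ℕ) : ℝ) + 2) +
              2 * (4 * (((((P.d + 2) * P.L : ℕ) : ℝ) ^ 2 / 4) * θW) + ((((P.d + 2) * P.L : ℕ) : ℝ) ^ 2 / 4) * θU) * (((P.d + 2) * P.L : ℕ) : ℝ)) *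
          (√(((3 ^ P.d * P.L ^ P.d * P.d : ℕ) : ℝ) * ((3 ^ P.d * P.L ^ P.d * P.d : ℕ) : ℝ)) * √(∑ b : PBond P j, dist1 (bdev U U₀ b) ^ 2)) +
        √((P.L ^ (P.d - 1) : ℕ) : ℝ) *
          ((3 * (((((P.d + 2) * P.L : ℕ) : ℝ) ^ 2 / 4))) * √(((3 ^ P.d * P.L ^ P.d * P.d ^ 2 : ℕ) : ℝ) * ((3 ^ P.d * P.d : ℕ) : ℝ)) *
              √(∑ q : Plaq P j, dist1 ((GaugeField.plaqHol W₀ q)⁻¹ * GaugeField.plaqHol W q) ^ 2) +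
            (3 * ((((P.d + 2) * P.L : ℕ) : ℝ) ^ 2 / 4 * (2 * θW * ((((P.d + 2) * P.L : ℕ) : ℝ) + 2)))) *
                √(((3 ^ P.d * P.L ^ P.d * P.d : ℕ) : ℝ) * ((3 ^ P.d * P.d : ℕ) : ℝ)) *
              √(∑ b : PBond P j, dist1 (bdev W W₀ b) ^ 2)) := by
  classical
  have hK0 : (0 : ℝ) ≤ (((P.d + 2) * P.L : ℕ) : ℝ) ^ 2 / 4 := by positivity
  have hcW0 : (0 : ℝ) ≤ 2 * (((((P.d + 2) * P.L : ℕ) : ℝ) ^ 2 / 4) * θW) * ((((P.d + 2) * P.L : ℕ) : ℝ) + 2) := by positivity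
  have hcU0 : (0 : ℝ) ≤ 2 * (((((P.d + 2) * P.L : ℕ) : ℝ) ^ 2 / 4) * θU) * ((((P.d + 2) * P.L : ℕ) : ℝ) + 2) +
      2 * (4 * (((((P.d + 2) * P.L : ℕ) : ℝ) ^ 2 / 4) * θW) + ((((P.d + 2) * P.L : ℕ) : ℝ) ^ 2 / 4) * θU) * (((P.d + 2) * P.L : ℕ) : ℝ) := by
    positivity
  -- Minkowski over the five pointwise terms of §2
  have hM := sqrt_sum_sq_le_of_le_add5 (Finset.univ : Finset (PBond P j)) (fun b => dist1 ((W₀ b * (U₀ b)⁻¹)⁻¹ * (W b * (U b)⁻¹)))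
    (fun b => ((((P.d + 2) * P.L : ℕ) : ℝ) ^ 2 / 4) *
      ∑ q ∈ Finset.univ.filter (fun q : Plaq P j => ∀ κ, blockOf q.src κ = blockOf b.src κ ∨ blockOf q.src κ = blockOf b.src κ + 1 ∨
        blockOf q.src κ = blockOf b.src κ - 1), dist1 ((GaugeField.plaqHol W₀ q)⁻¹ * GaugeField.plaqHol W q))
    (fun b => ((((P.d + 2) * P.L : ℕ) : ℝ) ^ 2 / 4) *
      ∑ q ∈ Finset.univ.filter (fun q : Plaq P j => ∀ κ, blockOf q.src κ = blockOf b.src κ ∨ blockOf q.src κ = blockOf b.src κ + 1 ∨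
        blockOf q.src κ = blockOf b.src κ - 1), dist1 ((GaugeField.plaqHol U₀ q)⁻¹ * GaugeField.plaqHol U q))
    (fun b => (2 * (((((P.d + 2) * P.L : ℕ) : ℝ) ^ 2 / 4) * θW) * ((((P.d + 2) * P.L : ℕ) : ℝ) + 2)) *
      ∑ b' ∈ Finset.univ.filter (fun b' : PBond P j => ∀ κ, blockOf b'.src κ = blockOf b.src κ ∨ blockOf b'.src κ = blockOf b.src κ + 1 ∨
        blockOf b'.src κ = blockOf b.src κ - 1), dist1 (bdev W W₀ b'))
    (fun b => (2 * (((((P.d + 2) * P.L : ℕ) : ℝ) ^ 2 / 4) * θU) * ((((P.d + 2) * P.L : ℕ) : ℝ) + 2) +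
        2 * (4 * (((((P.d + 2) * P.L : ℕ) : ℝ) ^ 2 / 4) * θW) + ((((P.d + 2) * P.L : ℕ) : ℝ) ^ 2 / 4) * θU) * (((P.d + 2) * P.L : ℕ) : ℝ)) *
      ∑ b' ∈ Finset.univ.filter (fun b' : PBond P j => ∀ κ, blockOf b'.src κ = blockOf b.src κ ∨ blockOf b'.src κ = blockOf b.src κ + 1 ∨
        blockOf b'.src κ = blockOf b.src κ - 1), dist1 (bdev U U₀ b'))
    (fun b => if (b.src b.dir).val % P.L + 1 = P.L then
      dist1 ((corr (expMeanLogSU (n := n)) W₀ ⟨blockOf b.src, b.dir⟩)⁻¹ * corr (expMeanLogSU (n := n)) W ⟨blockOf b.src, b.dir⟩) else 0)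
    (fun b _ => GaugeGroup.dist1_nonneg _)
    (fun b _ => dist1_flap_rel_le_nbhd_SU hj W U W₀ U₀ hax hax₀ havg havg₀ hθW0 hθU0 hW hU hθW4 hθWN b.src b.dir)
  -- each term in `ℓ²`
  have h1 := sqrt_sum_sq_nbhdP_le hj (fun q : Plaq P j => dist1 ((GaugeField.plaqHol W₀ q)⁻¹ * GaugeField.plaqHol W q))
  have h2 := sqrt_sum_sq_nbhdP_le hj (fun q : Plaq P j => dist1 ((GaugeField.plaqHol U₀ q)⁻¹ * GaugeField.plaqHol U q))
  have h3 := sqrt_sum_sq_nbhdB_le hj (fun b : PBond P j => dist1 (bdev W W₀ b))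
  have h4 := sqrt_sum_sq_nbhdB_le hj (fun b : PBond P j => dist1 (bdev U U₀ b))
  have h5 := (sqrt_sum_face_sq_le hj (fun c => dist1 ((corr (expMeanLogSU (n := n)) W₀ c)⁻¹ * corr (expMeanLogSU (n := n)) W c))).trans
    (mul_le_mul_of_nonneg_left (sqrt_sum_dist1_corr_rel_sq_le hj W W₀ hθW0 hθW₀0 hW hW₀ hθWN hθW₀N) (Real.sqrt_nonneg _))
  rw [sqrt_sum_mul_sq _ _ hK0, sqrt_sum_mul_sq _ _ hK0, sqrt_sum_mul_sq _ _ hcW0, sqrt_sum_mul_sq _ _ hcU0] at hM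
  have h1' := mul_le_mul_of_nonneg_left h1 hK0
  have h2' := mul_le_mul_of_nonneg_left h2 hK0
  have h3' := mul_le_mul_of_nonneg_left h3 hcW0
  have h4' := mul_le_mul_of_nonneg_left h4 hcU0
  linarith [hM, h1', h2', h3', h4', h5]

/-- ★★★ **(F2-rel) IN px12's CHORD ORIENTATION** `dist1 (P·P⁰⁻¹)` with `P = W₀·U₀⁻¹` (history flap) and `P⁰ = W·U⁻¹` (background flap): the same bound
(`dist1 (X₀·X⁻¹) = dist1 (X₀⁻¹·X)` by ✓`dist1_inv` + ✓`dist1_mul_inv_eq_rel`). [cite: Balaban1985RegularSpaces, Lemma 1 (1.25)-(1.26) pp.79-80; Balaban1987RG1, (0.4) p.253] -/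
theorem sqrt_sum_dist1_flap_rel_sq_le' (hj : j + 1 ≤ P.m + P.K) (W U W₀ U₀ : GaugeField P j (Matrix.specialUnitaryGroup n ℂ))
    (hax : ∀ z : Site P j, axialT W (emb (blockOf z)) z = axialT U (emb (blockOf z)) z)
    (hax₀ : ∀ z : Site P j, axialT W₀ (emb (blockOf z)) z = axialT U₀ (emb (blockOf z)) z)
    (havg : ∀ c : PBond P (j + 1), AveragingRT.axialAvg U c = avgFun (expMeanLogSU (n := n)) W c)
    (havg₀ : ∀ c : PBond P (j + 1), AveragingRT.axialAvg U₀ c = avgFun (expMeanLogSU (n := n)) W₀ c)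
    {θW θU θW₀ : ℝ} (hθW0 : 0 ≤ θW) (hθU0 : 0 ≤ θU) (hθW₀0 : 0 ≤ θW₀)
    (hW : PlaqSmall θW W) (hU : PlaqSmall θU U) (hW₀ : PlaqSmall θW₀ W₀)
    (hθW4 : ((((P.d + 2) * P.L : ℕ) : ℝ) ^ 2 / 4) * θW ≤ 1 / 4) (hθWN : ((((P.d + 2) * P.L : ℕ) : ℝ) ^ 2 / 4) * θW < deltaSU n)
    (hθW₀N : ((((P.d + 2) * P.L : ℕ) : ℝ) ^ 2 / 4) * θW₀ < deltaSU n) :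
    √(∑ b : PBond P j, dist1 ((W₀ b * (U₀ b)⁻¹) * (W b * (U b)⁻¹)⁻¹) ^ 2) ≤
      ((((P.d + 2) * P.L : ℕ) : ℝ) ^ 2 / 4) * (√(((3 ^ P.d * P.L ^ P.d * P.d ^ 2 : ℕ) : ℝ) * ((3 ^ P.d * P.L ^ P.d * P.d : ℕ) : ℝ)) *
          √(∑ q : Plaq P j, dist1 ((GaugeField.plaqHol W₀ q)⁻¹ * GaugeField.plaqHol W q) ^ 2)) +
        ((((P.d + 2) * P.L : ℕ) : ℝ) ^ 2 / 4) * (√(((3 ^ P.d * P.L ^ P.d * P.d ^ 2 : ℕ) : ℝ) * ((3 ^ P.d * P.L ^ P.d * P.d : ℕ) : ℝ)) *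
          √(∑ q : Plaq P j, dist1 ((GaugeField.plaqHol U₀ q)⁻¹ * GaugeField.plaqHol U q) ^ 2)) +
        (2 * (((((P.d + 2) * P.L : ℕ) : ℝ) ^ 2 / 4) * θW) * ((((P.d + 2) * P.L : ℕ) : ℝ) + 2)) *
          (√(((3 ^ P.d * P.L ^ P.d * P.d : ℕ) : ℝ) * ((3 ^ P.d * P.L ^ P.d * P.d : ℕ) : ℝ)) * √(∑ b : PBond P j, dist1 (bdev W W₀ b) ^ 2)) +
        (2 * (((((P.d + 2) * P.L : ℕ) : ℝ) ^ 2 / 4) * θU) * ((((P.d + 2) * P.L : ℕ) : ℝ) + 2) +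
              2 * (4 * (((((P.d + 2) * P.L : ℕ) : ℝ) ^ 2 / 4) * θW) + ((((P.d + 2) * P.L : ℕ) : ℝ) ^ 2 / 4) * θU) * (((P.d + 2) * P.L : ℕ) : ℝ)) *
          (√(((3 ^ P.d * P.L ^ P.d * P.d : ℕ) : ℝ) * ((3 ^ P.d * P.L ^ P.d * P.d : ℕ) : ℝ)) * √(∑ b : PBond P j, dist1 (bdev U U₀ b) ^ 2)) +
        √((P.L ^ (P.d - 1) : ℕ) : ℝ) *
          ((3 * (((((P.d + 2) * P.L : ℕ) : ℝ) ^ 2 / 4))) * √(((3 ^ P.d * P.L ^ P.d * P.d ^ 2 : ℕ) : ℝ) * ((3 ^ P.d * P.d : ℕ) : ℝ)) *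
              √(∑ q : Plaq P j, dist1 ((GaugeField.plaqHol W₀ q)⁻¹ * GaugeField.plaqHol W q) ^ 2) +
            (3 * ((((P.d + 2) * P.L : ℕ) : ℝ) ^ 2 / 4 * (2 * θW * ((((P.d + 2) * P.L : ℕ) : ℝ) + 2)))) *
                √(((3 ^ P.d * P.L ^ P.d * P.d : ℕ) : ℝ) * ((3 ^ P.d * P.d : ℕ) : ℝ)) *
              √(∑ b : PBond P j, dist1 (bdev W W₀ b) ^ 2)) := by
  have e : ∀ b : PBond P j, dist1 ((W₀ b * (U₀ b)⁻¹) * (W b * (U b)⁻¹)⁻¹) = dist1 ((W₀ b * (U₀ b)⁻¹)⁻¹ * (W b * (U b)⁻¹)) := fun b => by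
    rw [← GaugeGroup.dist1_inv ((W₀ b * (U₀ b)⁻¹) * (W b * (U b)⁻¹)⁻¹), mul_inv_rev, inv_inv,
      FluctuationComparisonRegPrIntLS2BetaRelativeStokes.dist1_mul_inv_eq_rel]
  simp only [e]
  exact sqrt_sum_dist1_flap_rel_sq_le hj W U W₀ U₀ hax hax₀ havg havg₀ hθW0 hθU0 hθW₀0 hW hU hW₀ hθW4 hθWN hθW₀N

end SUN

end Summit.QuantumFields.YangMills.Theorems.FluctuationComparisonRegPrIntLS2BetaRelativeFieldLetterTwoTowerL2

end
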